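import Summits.QuantumFields.BalabanUV.T4Continuum.Support.AveragingDeficitTorusChart
import HarnessLib

/-!
# NE7CovariantConstancyBox — A COVARIANTLY CONSTANT BOX FIELD VANISHING AT ONE SITE VANISHES (the infinitesimal gauge stabiliser with a trivial corner is trivial): on the box
# `[0,M)^d` with neighbour map `r ↦ r + e_κ mod M`, if `ζ(r + e_κ) = T(r,κ) ζ(r)` for arbitrary maps `T(r,κ)` sending `0` to `0` (e.g. `X ↦ W(b)⁻¹XW(b)`) and `ζ 0 = 0`, then `ζ = 0` —
# the injectivity of `ζ̇ ↦ ∇_W ζ̇` on trivial-corner gauge directions needed by the slice theorem of the C¹ rung (ROAD-G114 §7–§9: `local_slice` with `𝔊₁` = trivial-corner fields)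

Cell `pub-balaban`, rung (B)+1 sub-cell t4, lineage `b2b-balaban-t4-ne7-p1` (CRUX PROVER NE7 #1 = OWNER of BINDER row NE7), generation 114.  Memo `t4/b2b-balaban-t4-ne7-p1-g114/ROAD-G114.md` §9.
THE ARGUMENT: induction on `Σ_i (r_i : ℕ)`; a nonzero index has a coordinate `r_i > 0`, its predecessor `r − e_i` has smaller sum and neighbour `r`.
WHAT ([folklore]; 0 def, 0 sorry).  `redN_boxVec_add_e`, **`eq_zero_of_propagate`**, `eq_zero_of_covariantly_constant`.
HONEST FRAMING (page 1): elementary combinatorics; nothing of Bałaban's; NOT NE7, NOT NE3; spine 0∕9; finite T⁴ rung (B)+1 — NOT infinite volume, NOT mass gap, NOT BetaPertH, NOT Clay.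
-/

set_option autoImplicit false

open scoped BigOperators
open Finset

namespace Summit.QuantumFields.BalabanUV.T4Continuum.NE7CovariantConstancyBox

open Literature.MathematicalPhysics.QuantumFieldTheory.Balaban1983to89
open B7Prop1Explicit
open AveragingDeficitTorusChart (redN coe_redN redN_boxVec)

variable {d : ℕ}

/-- The successor index: `redN M (boxVec M r + e i)` has `i`-th coordinate `(r i + 1) mod M` and the other coordinates those of `r`. [folklore] -/
theorem redN_boxVec_add_e (M : ℕ) [NeZero M] (r : Fin d → Fin M) (i j : Fin d) :
    ((redN M (boxVec M r + e i) j : ℕ) : ℤ) = if j = i then (((r i : ℕ) : ℤ) + 1) % (M : ℤ) else ((r j : ℕ) : ℤ) := by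
  rw [coe_redN]
  simp only [Pi.add_apply, boxVec, e, Pi.single_apply]
  by_cases h : j = i
  · subst h; simp
  · simp only [h, ↓reduceIte, add_zero]
    exact Int.emod_eq_of_lt (by positivity) (by exact_mod_cast (r j).isLt)

/-- **PROPAGATION FROM THE ORIGIN**: a predicate on the box indices holding at `0` and propagating along every `r ↦ r + e_i (mod M)` holds everywhere. [folklore] -/
theorem eq_zero_of_propagate (M : ℕ) [NeZero M] {P : (Fin d → Fin M) → Prop} (h0 : P (fun _ => ⟨0, Nat.pos_of_ne_zero (NeZero.ne M)⟩))
    (hstep : ∀ (r : Fin d → Fin M) (i : Fin d), P r → P (redN M (boxVec M r + e i))) : ∀ r, P r := by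
  -- induction on the coordinate sum
  suffices H : ∀ (s : ℕ) (r : Fin d → Fin M), (∑ j, (r j : ℕ)) = s → P r from fun r => H _ r rfl
  intro s
  induction s with
  | zero =>
      intro r hr
      have hz : ∀ j, (r j : ℕ) = 0 := fun j => by
        have := Finset.sum_eq_zero_iff.mp hr j (Finset.mem_univ j); exact this
      have : r = fun _ => ⟨0, Nat.pos_of_ne_zero (NeZero.ne M)⟩ := funext fun j => Fin.ext (hz j)
      rw [this]; exact h0
  | succ s ih =>
      intro r hr
      -- a coordinate is positive
      have hex : ∃ i, 0 < (r i : ℕ) := by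
        by_contra hno
        have hno' : ∀ i, (r i : ℕ) = 0 := fun i => Nat.eq_zero_of_not_pos fun h => hno ⟨i, h⟩
        have : (∑ j, (r j : ℕ)) = 0 := Finset.sum_eq_zero fun j _ => hno' j
        omega
      obtain ⟨i, hi⟩ := hex
      -- the predecessor `r′ = r − e_i`
      set r' : Fin d → Fin M := fun j => if j = i then ⟨(r i : ℕ) - 1, by have := (r i).isLt; omega⟩ else r j with hr'
      have hsum : (∑ j, (r' j : ℕ)) = s := by
        have h1 : (∑ j, (r' j : ℕ)) + 1 = ∑ j, (r j : ℕ) := by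
          rw [← Finset.sum_erase_add _ _ (Finset.mem_univ i), ← Finset.sum_erase_add _ (fun j => (r j : ℕ)) (Finset.mem_univ i)]
          have h2 : ∑ j ∈ Finset.univ.erase i, (r' j : ℕ) = ∑ j ∈ Finset.univ.erase i, (r j : ℕ) :=
            Finset.sum_congr rfl fun j hj => by simp [hr', Finset.ne_of_mem_erase hj]
          rw [h2]
          simp only [hr', ↓reduceIte]
          omega
        omega
      have hnext : redN M (boxVec M r' + e i) = r := by
        funext j
        apply Fin.ext
        have h := redN_boxVec_add_e M r' i j
        by_cases hj : j = i
        · subst hj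
          simp only [↓reduceIte, hr'] at h
          have hlt : ((r j : ℕ) : ℤ) - 1 + 1 < (M : ℤ) := by have := (r j).isLt; omega
          rw [Nat.cast_sub (by omega), Nat.cast_one, sub_add_cancel, Int.emod_eq_of_lt (by positivity) (by exact_mod_cast (r j).isLt)] at h
          exact_mod_cast h
        · simp only [hj, ↓reduceIte, hr'] at h
          exact_mod_cast h
      have := hstep r' i (ih r' hsum)
      rwa [hnext] at this

/-- **A COVARIANTLY CONSTANT BOX FIELD VANISHING AT THE ORIGIN VANISHES**: if `ζ(r + e_κ mod M) = T r κ (ζ r)` with `T r κ 0 = 0` for all `r, κ`, and `ζ 0 = 0`, then `ζ = 0`. [folklore] -/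
theorem eq_zero_of_covariantly_constant {α : Type*} [Zero α] (M : ℕ) [NeZero M] (ζ : (Fin d → Fin M) → α) (T : (Fin d → Fin M) → Fin d → α → α)
    (hT : ∀ r κ, T r κ 0 = 0) (hcov : ∀ (r : Fin d → Fin M) (κ : Fin d), ζ (redN M (boxVec M r + e κ)) = T r κ (ζ r))
    (h0 : ζ (fun _ => ⟨0, Nat.pos_of_ne_zero (NeZero.ne M)⟩) = 0) : ∀ r, ζ r = 0 :=
  eq_zero_of_propagate M (P := fun r => ζ r = 0) h0 fun r i hr => by rw [hcov, hr, hT]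

end Summit.QuantumFields.BalabanUV.T4Continuum.NE7CovariantConstancyBox
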